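import Literature.NumberTheory.LFunctions.ZeroStatistics
import Literature.NumberTheory.LFunctions.ZetaArgVariation
import HarnessLib

/-!
# `n < N(T) ↔ γ_n ≤ T`: discharge of `Literature.NumberTheory.LFunctions.mem_zeroIndexSet_iff` — proved

Trunk T-ANT (`Literature/NumberTheory/LFunctions`). Proofs only (no new definitions, no named
facts). Companion of `ZeroStatistics.lean` (family `rh`, rh.S31/S32), which defines
`zeroIndexSet T := Finset.range N(T)` and states the bridge
`mem_zeroIndexSet_iff : n ∈ zeroIndexSet T ↔ γ_n ≤ T` as a named fact.

Here `γ_n := inf {T | n + 1 ≤ N(T)}` (`Literature.NumberTheory.LFunctions.zetaOrdinate`, `ZetaZeros.lean`; 0-indexed, repeated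
according to multiplicity) and `N(T)` counts the zeros `β + iγ` of `ζ` with `0 < γ ≤ T` with
multiplicity (Titchmarsh §9.1). The bridge `n < N(T) ↔ γ_n ≤ T` is the statement that the
infimum defining `γ_n` is taken over a *nonempty* set and is attained. Nonemptiness for every
`n` is exactly the unboundedness of `N`, i.e. `N(T) → ∞` — without it `γ_n` would be the junk
value `sInf ∅ = 0 ≤ T` for large `n` while `n ∉ Finset.range N(T)`, so the deep input (that `ζ`
has infinitely many non-trivial zeros) is unavoidable. The tree now proves the Riemann–von
Mangoldt formula `N(T) = (T/2π) log(T/2π) − T/2π + O(log T)` (Titchmarsh Thm. 9.4;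
`Literature.NumberTheory.LFunctions.riemann_von_mangoldt_holds`, `ZetaArgVariation.lean`), and `ZeroCountingProofs.lean` derives
from it, using the right-continuity and monotonicity of `N` (`exists_zetaZeroCount_add_eq`,
`zetaZeroCount_mono`), the attained-infimum characterisation
`Literature.riemann_von_mangoldt.zetaOrdinate_le_iff : γ_n ≤ T ↔ n + 1 ≤ N(T)`.
The discharge below is that characterisation read through `Finset.mem_range`.

## Main results (namespace `Literature`, proved)

* `mem_zeroIndexSet_iff_holds : mem_zeroIndexSet_iff`.

## References

* E. C. Titchmarsh, *The Theory of the Riemann Zeta-Function*, 2nd ed. (rev. D. R. Heath-Brown),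
  Oxford 1986, §9.1 (`N(T)` and the ordinates `γ_n`), Thm. 9.4 (Riemann–von Mangoldt formula).
-/

noncomputable section

namespace Literature.NumberTheory.LFunctions

/-- **Discharge of the named fact `Literature.NumberTheory.LFunctions.mem_zeroIndexSet_iff`** (`ZeroStatistics.lean`;
Titchmarsh §9.1: `N(T)` counts the zeros `0 < γ ≤ T` with multiplicity and
`0 < γ₁ ≤ γ₂ ≤ …` enumerate them): `n ∈ zeroIndexSet T = Finset.range N(T) ↔ γ_n ≤ T`, i.e.
`n < N(T) ↔ γ_n ≤ T`. Proof: `γ_n ≤ T ↔ n + 1 ≤ N(T)`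
(`riemann_von_mangoldt.zetaOrdinate_le_iff`, fed with `riemann_von_mangoldt_holds`; it uses
`N(T) → ∞`, so that the infimum defining `γ_n` is over a nonempty set, and the right-continuity
of `N`, so that it is attained). [cite: Titchmarsh1986, §9.1] -/
theorem mem_zeroIndexSet_iff_holds : mem_zeroIndexSet_iff := by
  intro T n
  rw [zeroIndexSet, Finset.mem_range, riemann_von_mangoldt_holds.zetaOrdinate_le_iff,
    Nat.add_one_le_iff]

end Literature.NumberTheory.LFunctions

end
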